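import Summits.ABC.StewartYu.PadicW80ParLA
import HarnessLib

/-!
# The `q = 3` (`p = 2`) Waldschmidt parameter record — the definitions (base-3 levels, ×3 inner steps)

Support file (plain definitions ONLY — every inequality is in the theorem-only sequels `PadicW80Par3A/…`;
no named facts), cell `abc-stewartyu` (seat p1; crux `W80Two`, stmt-ABC-19486; design memo
HOME/p1/S2-q3-record-design.md, decision «×3 inner steps» STATUS 2026-08-26 11:16Z).  The `2`-adic member
of the Theorem-A family descends through CUBE roots (Yu's `q = 3` for `p = 2`): the levels are `3ᴶ` (ranges
`Lⱼ/3ᴶ`, multiplicities `T/3ᴶ`), the points of level `J` are the `s < 3ᴶ S₀` with `3 ∤ s` (density `2/3`;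
`3 ∣ S₀`), and the inner extrapolation steps TRIPLE the range (the third-step Liouville exponent is
`≍ 3^{d+2}`, so the number of zeros must grow like `3ᵏ`).  The record is the landed STRUCTURE
`PadicW80ParL d` (fields `V, Vm, Vθ, W, ℓ, Mcl`; at `p = 2`: `ℓ = 1`, `Mcl = 1`), whose `U = Uℓ`, `W⋆`,
`G`, `h = hparℓ` and normalised sizes are REUSED; this file adds the base-`3` derived parameters
`S₀3, T3, Lb3, L3, Lθ3, J₀3, 𝔘3 = U/3ᵐ, tJ3, kpts3, Xpt3, Vall/Lall3`, the fine unit `𝔔3 = exp(𝔘3/1024)`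
(`𝔅3 = 𝔔3¹⁶`), the height unit `Efac3 c = exp(c·𝔘3/(3c_L'))` and the SHARP closed-form sizes of the inner
steps (`DmaxK3, MmaxK3`), of Siegel's step (`Amax3, PrV3`) and of the third step (`DmaxT3, RThird3, MmaxT3`).
Constants `c_T = c_L = 2¹⁴, c_S = 2¹⁵, c_L' = 2¹², A = 2⁵⁰` are those of `PadicW80Par`.

## References
* [Yu1989] K. Yu, *Linear forms in p-adic logarithms*, Acta Arith. 53 (1989), §3 (the `q`-descent,
  `q = 3` when `p = 2`; Lemma 3.3: extrapolation `q^{J+k}S → q^{J+k+1}S`).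
* [Yu1990] K. Yu, *Linear forms in p-adic logarithms II*, Compositio Math. 74 (1990), (2.1), (2.30)–(2.31).
* [Waldschmidt1980] M. Waldschmidt, *A lower bound for linear forms in logarithms*, Acta Arith. 37 (1980),
  §3.2 (3.2)–(3.14) (pp. 264–265).
-/

noncomputable section

open Finset Real

namespace Summit.ABC.StewartYu

open PadicW80Par (cTp cSp cLp cLp' Ap mRp)

namespace PadicW80ParL

variable {d : ℕ} (P : PadicW80ParL d)

/-! ### The base-3 derived parameters -/

/-- `S₀ = 3 ⌊c_S m nW⋆⌋`: a multiple of `3`; the points of level `0` are the `s < S₀` with `3 ∤ s`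
(Yu's `S = q[c₃(n+1)DW*/(f log p)]` with `q = 3`). [cite: Yu1990, (2.31) (p. 36)] [cite: Yu1989, §3] -/
def S₀3 : ℕ := 3 * ⌊cSp * mRp d * P.nWstarℓ⌋₊

/-- `T = ⌊U/(c_T 3ᵐ W⋆)⌋` (`m = d + 1`; `3ᵐ` because the last inner step has `3ᵈ` times the points of the
first). [cite: Waldschmidt1980, (3.2) p. 264] -/
def T3 : ℕ := ⌊P.Uℓ / (cTp * 3 ^ (d + 1) * P.Wstarℓ)⌋₊

/-- `L_b = ⌊U/(c_L 3ᵐ G h)⌋ + 1` (the number of blocks of `Δ`-polynomials). [cite: Waldschmidt1980, (3.2) p. 264] -/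
def Lb3 : ℕ := ⌊P.Uℓ / (cLp * 3 ^ (d + 1) * P.Gℓ * P.hparℓ)⌋₊ + 1

/-- `Lⱼ = ⌊U/(c_L' m 3^{m+1} S₀ Vⱼ)⌋`. [cite: Waldschmidt1980, (3.2) p. 264] -/
def L3 (j : Fin d) : ℕ := ⌊P.Uℓ / (cLp' * mRp d * 3 ^ (d + 2) * P.S₀3 * P.V j)⌋₊

/-- `L_θ = ⌊U/(c_L' m 3^{m+1} S₀ V_θ)⌋` (the smallest range). [cite: Waldschmidt1980, (3.2) p. 264] -/
def Lθ3 : ℕ := ⌊P.Uℓ / (cLp' * mRp d * 3 ^ (d + 2) * P.S₀3 * P.Vθ)⌋₊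

/-- `J₀ = [log₃ L_θ] + 1` descent steps (`L_θ < 3^{J₀} ≤ 3 L_θ`). [cite: Yu1989, §3] [cite: Waldschmidt1980, §3.5 (p. 274)] -/
def J₀3 : ℕ := Nat.log 3 P.Lθ3 + 1

/-- The unit `𝔘 = U / 3ᵐ` (`m = d + 1`). [cite: Waldschmidt1980, §3.3 (3.19) (p. 269)] -/
def 𝔘3 : ℝ := P.Uℓ / 3 ^ (d + 1)

/-- The common bound `𝔅 = exp(𝔘/64)` of the moderate quantities. [folklore] -/
def 𝔅3 : ℝ := Real.exp (P.𝔘3 / 64)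

/-- **The fine unit `𝔔 = exp(𝔘/1024)`** of the sharp sizes (`𝔔¹⁶ = 𝔅`). [folklore] -/
def 𝔔3 : ℝ := Real.exp (P.𝔘3 / 1024)

/-- `t_J = 2⌊T/3^{J+1}⌋/(d+1)`: the number of derivatives given up at each of the `d` inner steps and at the
third step of level `J` (`(d+1)·t_J + ⌊T/3^{J+1}⌋ ≤ ⌊T/3ᴶ⌋`). [cite: Waldschmidt1980, Lemma 3.6 (p. 272)] [cite: Yu1989, §3] -/
def tJ3 (J : ℕ) : ℕ := 2 * (P.T3 / 3 ^ (J + 1)) / (d + 1)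

/-- `kpts = #{s < 3^{k+J} S₀ : 3 ∤ s} = 2 · 3^{k+J} · (S₀/3)`: the nodes of the `k`-th inner step of level `J`
(`k = d`: the zeros feeding the third step). [cite: Yu1989, §3 Lemma 3.3] -/
def kpts3 (J k : ℕ) : ℕ := 2 * 3 ^ (k + J) * (P.S₀3 / 3)

/-- The largest (scaled) evaluation point of the `Δ`-polynomials: `X = 3^{d+2} L_θ S₀`
(`3^{J₀−J}·s ≤ 3^{J₀}·3^{d+1} S₀ ≤ 3 L_θ · 3^{d+1} S₀`). [folklore] -/
def Xpt3 : ℝ := 3 ^ (d + 2) * P.Lθ3 * P.S₀3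

/-- All the ranges: `L` extended by `L_θ`. [folklore] -/
def Lall3 : Fin (d + 1) → ℕ := Fin.snoc P.L3 P.Lθ3

/-- The height unit `E(c) = exp(c · 𝔘/(3c_L'))` (`S₀·(∑ LⱼVⱼ + L_θV_θ) ≤ 𝔘/(3c_L')`). [folklore] -/
def Efac3 (c : ℝ) : ℝ := Real.exp (c * (P.𝔘3 / (3 * cLp')))

/-! ### The sharp closed-form sizes (fine unit `𝔔`) -/

/-- **`Amax = 𝔔²¹ E(3)`**: the bound of Siegel's step `|D(s,τ)·qTerm₃| ≤ Amax` on the box of level `0`, `s < S₀`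
(`D ≤ 𝔔¹⁶E(1)`, `|qTerm₃| ≤ 𝔔⁵E(1)`; stated with `E(3) ≥ E(2)` for uniformity). [folklore] -/
def Amax3 : ℝ := P.𝔔3 ^ 21 * P.Efac3 3

/-- **`PrV = 2 𝔔²² E(3)`**: the bound of the integer coefficients `|p(u)| ≤ ⌈#box₀ · Amax⌉ ≤ PrV`. [folklore] -/
def PrV3 : ℝ := 2 * P.𝔔3 ^ 22 * P.Efac3 3

/-- `Dmax_k = 𝔔¹⁶ E(3^{k+1})` (the clearing denominators of the `k`-th inner step: points `s < 3^{k+1+J} S₀`). [folklore] -/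
def DmaxK3 (k : ℕ) : ℝ := P.𝔔3 ^ 16 * P.Efac3 ((3 ^ (k + 1) : ℕ) : ℝ)

/-- `Mmax_k = 𝔔 · PrV · 𝔔⁵ E(3^{k+1})` (the archimedean size `∑_u |p(u)|·|qTerm₃(u)|` of the cores of the `k`-th
inner step). [folklore] -/
def MmaxK3 (k : ℕ) : ℝ := P.𝔔3 * P.PrV3 * (P.𝔔3 ^ 5 * P.Efac3 ((3 ^ (k + 1) : ℕ) : ℝ))

/-- **`DmaxT = 𝔔¹⁶ E(3)`**: the clearing denominator at the third points (`s < 3^{J+1} S₀`). [folklore] -/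
def DmaxT3 : ℝ := P.𝔔3 ^ 16 * P.Efac3 3

/-- **`RThird = 𝔔⁵ E(3)`**: the archimedean size of one term `qΔ₃·qA·qEt` at a third point. [folklore] -/
def RThird3 : ℝ := P.𝔔3 ^ 5 * P.Efac3 3

/-- **`MmaxT = 𝔔 · PrV · RThird`** (`#box ≤ 𝔔`): the archimedean size `∑_{u ∈ box} |p(u)|·|qΔ₃ qA qEt(u)|` of the
class sums at a third point. [folklore] -/
def MmaxT3 : ℝ := P.𝔔3 * P.PrV3 * P.RThird3

end PadicW80ParL

end Summit.ABC.StewartYu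

end
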